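import Mathlib
import HarnessLib
import Summits.QuantumAdvantage.QuantumAdvantage.Theses.FeatureShadow
import Summits.QuantumAdvantage.AdviceFreeQNC0.FeatOfVPE
import Summits.QuantumAdvantage.AdviceFreeQNC0.PredHard
import Summits.QuantumAdvantage.AdviceFreeQNC0.WalkHardFShots
import Summits.QuantumAdvantage.AdviceFreeQNC0.WalkGapNaming
import Summits.QuantumAdvantage.AdviceFreeQNC0.ConstantBellsDense
import Summits.QuantumAdvantage.AdviceFreeQNC0.CleanGapStrategies
import Summits.QuantumAdvantage.AdviceFreeQNC0.FixedBellsSparse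
import Literature.Computability.MetaComplexity.RazborovSmolenskyPoly

/-!
# Route FeatureShadow (rung F-Q1-odd) — closing theorems, part 1/2: F₂-linearity, single-table bounds, the pair gap law, the K = 1 rung

Part 1 of 2, split for landing (≤ 400-line rule) by decomp-qadv-census-1 g5 — content VERBATIM from lens-4's FeatureShadowClosing.lean sha256 57f67465 (critic row 21 CLEARED; writer PB8: closing file of record). §A: `FeatureShadowClosing.pairGapLaw` (F₂-linearity of fixed-table wins `ringWinU_xor`, `two_mul_card_union`:
`2·#(W₀ ∪ W₁) = #W₀ + #W₁ + #W_{S₀ΔS₁}`, + the landed single-table bounds: ≥ 21 fired cuts ⇒ `2·#WIN ≤ (1 + 3(5/8)⁵)·2ⁿ`;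
≤ 20 fired cuts, n ≥ 187 ⇒ `3·#WIN ≤ 2·2ⁿ + 2·2ⁿ⁻⁷; γ = 1/200, B = 20, n₀ = 187), `walkHardFFeatOne_holds` (the K = 1 rung of P2⁺ for every
prime p ≠ 3 via the landed `walkHardFShots`). Part 2 (`FeatureShadowClosing`): §B routing edge, §C shadow glue and the BY-NAME closers of items
27002 PairGapLaw, 27001 WalkHardFFeatOneOdd, 27003, 27004, 27000 LevelSetEdgeOdd, 26997 ShadowGlue. RUNG CURRENCY ONLY — nothing here bears on `QuantumAdvantage`.
-/

set_option linter.dupNamespace false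

namespace Summit.QuantumAdvantage.QuantumAdvantage.Theorems

open Classical Finset
open Summit.QuantumAdvantage.AdviceFreeQNC0
open Literature.Computability.MetaComplexity Smolensky
open Summit.QuantumAdvantage.QuantumAdvantage.Theses

namespace FeatureShadowClosing

/-! ## §A  F₂-linearity, single-table bounds, the pair gap law and the K = 1 rung -/

section Linearity

variable {n : ℕ}

/-- the number of fired cuts of the fixed table `tab` that are charged at input `u`. -/
def cnt (c : ℕ) (tab : Fin (n + 1) → Bool) (u : Fin n → Bool) : ℕ :=
  (univ.filter fun g : Fin (n + 1) => tab g = true ∧ (c + g.val + walkExp u g.val) % 3 ≠ 0).card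

/-- the fixed table wins iff its charged-cut count is odd. -/
theorem ringWinU_tab (c : ℕ) (tab : Fin (n + 1) → Bool) (u : Fin n → Bool) :
    ringWinU c (fun h _ => tab h) u = decide (cnt c tab u % 2 = 1) := rfl

/-- pointwise count identity: `N_{S₀ΔS₁} + 2·N_{S₀∩S₁} = N_{S₀} + N_{S₁}`. -/
theorem cnt_xor_add (c : ℕ) (tab₀ tab₁ : Fin (n + 1) → Bool) (u : Fin n → Bool) :
    cnt c (fun h => xor (tab₀ h) (tab₁ h)) u +
      2 * (univ.filter fun g : Fin (n + 1) =>
        (tab₀ g = true ∧ tab₁ g = true) ∧ (c + g.val + walkExp u g.val) % 3 ≠ 0).card =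
    cnt c tab₀ u + cnt c tab₁ u := by
  unfold cnt
  simp only [Finset.card_filter]
  rw [Finset.mul_sum, ← Finset.sum_add_distrib, ← Finset.sum_add_distrib]
  refine Finset.sum_congr rfl fun g _ => ?_
  by_cases hq : (c + g.val + walkExp u g.val) % 3 ≠ 0
  · cases h₀ : tab₀ g <;> cases h₁ : tab₁ g <;> simp [hq]
  · cases h₀ : tab₀ g <;> cases h₁ : tab₁ g <;> simp [hq]

/-- **F₂-linearity**: the win bit of the symmetric-difference table is the XOR of the two win bits. -/
theorem ringWinU_xor (c : ℕ) (tab₀ tab₁ : Fin (n + 1) → Bool) (u : Fin n → Bool) :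
    ringWinU c (fun h _ => xor (tab₀ h) (tab₁ h)) u =
      xor (ringWinU c (fun h _ => tab₀ h) u) (ringWinU c (fun h _ => tab₁ h) u) := by
  have key := cnt_xor_add c tab₀ tab₁ u
  rw [ringWinU_tab, ringWinU_tab, ringWinU_tab]
  generalize (univ.filter fun g : Fin (n + 1) =>
      (tab₀ g = true ∧ tab₁ g = true) ∧ (c + g.val + walkExp u g.val) % 3 ≠ 0).card = M at key
  generalize cnt c (fun h => xor (tab₀ h) (tab₁ h)) u = N at key ⊢
  generalize cnt c tab₀ u = N₀ at key ⊢
  generalize cnt c tab₁ u = N₁ at key ⊢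
  rcases Nat.mod_two_eq_zero_or_one N₀ with h0 | h0 <;>
    rcases Nat.mod_two_eq_zero_or_one N₁ with h1 | h1
  · have hN : N % 2 = 0 := by omega
    rw [hN, h0, h1]; decide
  · have hN : N % 2 = 1 := by omega
    rw [hN, h0, h1]; decide
  · have hN : N % 2 = 1 := by omega
    rw [hN, h0, h1]; decide
  · have hN : N % 2 = 0 := by omega
    rw [hN, h0, h1]; decide

/-- **Exact union count**: `2·#(W₀ ∪ W₁) = #W₀ + #W₁ + #W_{S₀ΔS₁}`. -/
theorem two_mul_card_union (c : ℕ) (tab₀ tab₁ : Fin (n + 1) → Bool) :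
    2 * (univ.filter fun u : Fin n → Bool =>
        ringWinU c (fun h _ => tab₀ h) u = true ∨ ringWinU c (fun h _ => tab₁ h) u = true).card =
      (univ.filter fun u : Fin n → Bool => ringWinU c (fun h _ => tab₀ h) u = true).card +
      (univ.filter fun u : Fin n → Bool => ringWinU c (fun h _ => tab₁ h) u = true).card +
      (univ.filter fun u : Fin n → Bool => ringWinU c (fun h _ => xor (tab₀ h) (tab₁ h)) u = true).card := by
  simp only [Finset.card_filter]
  rw [Finset.mul_sum, ← Finset.sum_add_distrib, ← Finset.sum_add_distrib]
  refine Finset.sum_congr rfl fun u _ => ?_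
  rw [ringWinU_xor]
  cases h₀ : ringWinU c (fun h _ => tab₀ h) u <;> cases h₁ : ringWinU c (fun h _ => tab₁ h) u <;> simp

end Linearity

/-! ### Single-table extremal facts (from the tree) -/

section Tables

variable {n : ℕ}

/-- **dense tables win strictly less than `2/3`**: `≥ 21` fired cuts ⇒ `2·#WIN ≤ (1 + 3(5/8)⁵)·2ⁿ` (transfer pair contraction,
`ConstBells.sum_sgnU_ge`). -/
theorem two_mul_card_win_dense_le (c : ℕ) (tab : Fin (n + 1) → Bool)
    (h21 : 21 ≤ (univ.filter fun h : Fin (n + 1) => tab h = true).card) :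
    2 * ((univ.filter fun u : Fin n → Bool => ringWinU c (fun h _ => tab h) u = true).card : ℝ) ≤
      (1 + 3 * (5 / 8 : ℝ) ^ 5) * (2 : ℝ) ^ n := by
  set B := univ.filter fun h : Fin (n + 1) => tab h = true with hB
  have hy : (fun (h : Fin (n + 1)) (_ : Fin n → Bool) => tab h) = ConstBells.constY B := by
    funext h u; simp [ConstBells.constY, hB]
  rw [hy]
  have h1 := ConstBells.sum_sgnU c B
  have h2 := ConstBells.sum_sgnU_ge c B h21
  rw [h1] at h2
  linarith

/-- a fired-cut-free window of `ℓ` cuts strictly inside `(a, a + ℓ)`, `a + ℓ ≤ n`, gives `3·#WIN ≤ 2·2ⁿ + 2·2^{n−ℓ}`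
(`ringWinU_cleanGap_le` transported to `Fin n`). -/
theorem three_mul_card_win_window_le (c : ℕ) (tab : Fin (n + 1) → Bool) (a ℓ : ℕ) (haℓ : a + ℓ ≤ n)
    (hfree : ∀ g : Fin (n + 1), a < g.val → g.val < a + ℓ → tab g = false) :
    3 * (univ.filter fun u : Fin n → Bool => ringWinU c (fun h _ => tab h) u = true).card ≤
      2 * 2 ^ n + 2 * 2 ^ (n - ℓ) := by
  obtain ⟨q, rfl⟩ : ∃ q, n = a + ℓ + q := ⟨n - (a + ℓ), by omega⟩
  have h := ringWinU_cleanGap_le (p := a) (ℓ := ℓ) (q := q) c (fun h _ => tab h)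
    (fun g hg1 hg2 _ => hfree g hg1 hg2) (fun _ _ _ _ _ => rfl)
  have hq : a + ℓ + q - ℓ = a + q := by omega
  rw [hq]; exact h

/-- **sparse tables**: `≤ 20` fired cuts and `n ≥ 187` ⇒ `3·#WIN ≤ 2·2ⁿ + 2·2^{n−7}` (pigeonhole window + gap lemma). -/
theorem three_mul_card_win_sparse_le (c : ℕ) (hn : 187 ≤ n) (tab : Fin (n + 1) → Bool)
    (h20 : (univ.filter fun h : Fin (n + 1) => tab h = true).card ≤ 20) :
    3 * (univ.filter fun u : Fin n → Bool => ringWinU c (fun h _ => tab h) u = true).card ≤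
      2 * 2 ^ n + 2 * 2 ^ (n - 7) := by
  set B := univ.filter fun h : Fin (n + 1) => tab h = true with hB
  obtain ⟨a, ha, hrun⟩ := exists_bellfree_run (n + 1) B
  set m := (n + 1 - B.card) / (B.card + 1) with hm
  have hm8 : 8 ≤ m := by
    have h1 : 8 * (B.card + 1) ≤ n + 1 - B.card := by omega
    exact (Nat.le_div_iff_mul_le (by omega)).2 h1
  have hwin := three_mul_card_win_window_le c tab a (m - 1) (by omega)
    (fun g hg1 hg2 => by
      have hnot : g ∉ B := hrun g ⟨by omega, by omega⟩
      by_contra hcon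
      apply hnot
      rw [hB, mem_filter]
      exact ⟨mem_univ _, by simpa using hcon⟩)
  have hpow : 2 ^ (n - (m - 1)) ≤ 2 ^ (n - 7) := Nat.pow_le_pow_right (by norm_num) (by omega)
  exact le_trans hwin (Nat.add_le_add_left (Nat.mul_le_mul_left 2 hpow) _)

/-- uniform per-table bound for `n ≥ 187`: `384·#WIN ≤ 258·2ⁿ` (dense: `≤ 0.643`, sparse: `≤ 43/64`). -/
theorem card_win_table_le (c : ℕ) (hn : 187 ≤ n) (tab : Fin (n + 1) → Bool) :
    (384 : ℝ) * ((univ.filter fun u : Fin n → Bool => ringWinU c (fun h _ => tab h) u = true).card : ℝ) ≤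
      258 * (2 : ℝ) ^ n := by
  have h2n : (0 : ℝ) ≤ (2 : ℝ) ^ n := by positivity
  by_cases h21 : 21 ≤ (univ.filter fun h : Fin (n + 1) => tab h = true).card
  · have h := two_mul_card_win_dense_le c tab h21
    have hκ : (3 : ℝ) * (5 / 8 : ℝ) ^ 5 = 9375 / 32768 := by norm_num
    rw [hκ] at h
    linarith
  · have h := three_mul_card_win_sparse_le c hn tab (by omega)
    have h' : (3 : ℝ) * ((univ.filter fun u : Fin n → Bool => ringWinU c (fun h _ => tab h) u = true).card : ℝ) ≤
        2 * (2 : ℝ) ^ n + 2 * (2 : ℝ) ^ (n - 7) := by exact_mod_cast h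
    have hpow : (2 : ℝ) ^ n = (2 : ℝ) ^ 7 * (2 : ℝ) ^ (n - 7) := by
      rw [← pow_add]; congr 1; omega
    norm_num at hpow
    linarith

end Tables

/-! ### the pair gap law (27002) -/

/-- **The pair gap law** (item 27002 `FeatureShadow.PairGapLaw`): γ = 1/200, B = 20, n₀ = 187. -/
theorem pairGapLaw : FeatureShadow.PairGapLaw := by
  unfold FeatureShadow.PairGapLaw
  refine ⟨1 / 200, by norm_num, 20, 187, fun n hn c tab₀ tab₁ => ?_⟩
  by_cases hsp : (univ.filter fun h : Fin (n + 1) => tab₀ h = true).card ≤ 20 ∧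
      (univ.filter fun h : Fin (n + 1) => tab₁ h = true).card ≤ 20
  · exact Or.inl hsp
  · right
    have h2n : (0 : ℝ) ≤ (2 : ℝ) ^ n := by positivity
    have hκ : (3 : ℝ) * (5 / 8 : ℝ) ^ 5 = 9375 / 32768 := by norm_num
    have hU : (2 : ℝ) * ((univ.filter fun u : Fin n → Bool =>
        ringWinU c (fun h _ => tab₀ h) u = true ∨ ringWinU c (fun h _ => tab₁ h) u = true).card : ℝ) =
      ((univ.filter fun u : Fin n → Bool => ringWinU c (fun h _ => tab₀ h) u = true).card : ℝ) +
      ((univ.filter fun u : Fin n → Bool => ringWinU c (fun h _ => tab₁ h) u = true).card : ℝ) +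
      ((univ.filter fun u : Fin n → Bool => ringWinU c (fun h _ => xor (tab₀ h) (tab₁ h)) u = true).card : ℝ) := by
      exact_mod_cast two_mul_card_union c tab₀ tab₁
    have gΔ := card_win_table_le c hn (fun h => xor (tab₀ h) (tab₁ h))
    rcases not_and_or.mp hsp with h0 | h1
    · have hd := two_mul_card_win_dense_le c tab₀ (by omega)
      rw [hκ] at hd
      have g1 := card_win_table_le c hn tab₁
      linarith
    · have hd := two_mul_card_win_dense_le c tab₁ (by omega)
      rw [hκ] at hd
      have g0 := card_win_table_le c hn tab₀
      linarith

/-- `ShotsConstF p` for every prime `p ≠ 3`, from the tree theorem `walkHardFShots`. -/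
theorem shotsConstF_holds (p : ℕ) [Fact p.Prime] (hp3 : p ≠ 3) :
    ∃ θ : ℝ, θ < 1 ∧ ∀ C B : ℕ, ∃ n₀ : ℕ, ∀ n ≥ n₀, ∀ c : ℕ, ∀ y : Fin (n + 1) → (Fin n → Bool) → Bool,
      (∀ g, HasDegF p (y g) ((Nat.log 2 n) ^ C)) →
      (∀ u, (univ.filter fun g : Fin (n + 1) => y g u = true).card ≤ B) →
        ((univ.filter fun u : Fin n → Bool => ringWinU c y u = true).card : ℝ) ≤ θ * (2 : ℝ) ^ n := by
  obtain ⟨θ, hθ, H⟩ := walkHardFShots p hp3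
  refine ⟨θ, hθ, fun C B => ?_⟩
  obtain ⟨n₀, hn₀⟩ := H C
  obtain ⟨N₁, hN₁⟩ := DWalk.const_mul_logPow_le' (B ^ 3) (2 * C + 2)
  refine ⟨max n₀ N₁, fun n hn c y hdeg hshots => ?_⟩
  exact hn₀ n (le_trans (le_max_left _ _) hn) c B y hdeg hshots (hN₁ n (le_trans (le_max_right _ _) hn))

/-- a table entry composed with the feature has the feature's degree. -/
theorem hasDegF_tab {p : ℕ} [Fact p.Prime] {n D : ℕ} (f : (Fin n → Bool) → Bool) (hf : HasDegF p f D)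
    (t : Bool → Bool) : HasDegF p (fun u => t (f u)) D := by
  unfold HasDegF at hf ⊢
  rcases ht : (t false, t true) with ⟨a, b⟩
  have hta : t false = a := congrArg Prod.fst ht
  have htb : t true = b := congrArg Prod.snd ht
  cases a <;> cases b
  · have : (fun u => if t (f u) = true then (1 : ZMod p) else 0) = 0 := by
      funext u; cases hfu : f u <;> simp [hta, htb]
    rw [this]; exact Submodule.zero_mem _
  · have : (fun u => if t (f u) = true then (1 : ZMod p) else 0) = fun u => if f u = true then (1 : ZMod p) else 0 := by
      funext u; cases hfu : f u <;> simp [hta, htb]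
    rw [this]; exact hf
  · have : (fun u => if t (f u) = true then (1 : ZMod p) else 0) =
        (1 : CubeFn (ZMod p) n) - fun u => if f u = true then (1 : ZMod p) else 0 := by
      funext u; cases hfu : f u <;> simp [hta, htb, hfu]
    rw [this]; exact Submodule.sub_mem _ (one_mem_lowDeg D) hf
  · have : (fun u => if t (f u) = true then (1 : ZMod p) else 0) = (1 : CubeFn (ZMod p) n) := by
      funext u; cases hfu : f u <;> simp [hta, htb]
    rw [this]; exact one_mem_lowDeg D

/-- **K = 1 from the pair gap law and constant-shots hardness** (g2's reduction, verbatim). -/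
theorem walkHardFFeatOne_of_pairGap (p : ℕ) [Fact p.Prime] (hG : FeatureShadow.PairGapLaw)
    (hS : ∃ θ : ℝ, θ < 1 ∧ ∀ C B : ℕ, ∃ n₀ : ℕ, ∀ n ≥ n₀, ∀ c : ℕ, ∀ y : Fin (n + 1) → (Fin n → Bool) → Bool,
      (∀ g, HasDegF p (y g) ((Nat.log 2 n) ^ C)) →
      (∀ u, (univ.filter fun g : Fin (n + 1) => y g u = true).card ≤ B) →
        ((univ.filter fun u : Fin n → Bool => ringWinU c y u = true).card : ℝ) ≤ θ * (2 : ℝ) ^ n) :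
    ∃ θ : ℝ, θ < 1 ∧ ∀ C : ℕ, ∃ n₀ : ℕ, ∀ n ≥ n₀, ∀ c : ℕ, ∀ f : (Fin n → Bool) → Bool,
      ∀ tab : Fin (n + 1) → Bool → Bool, HasDegF p f ((Nat.log 2 n) ^ C) →
        ((univ.filter fun u : Fin n → Bool => ringWinU c (fun h u => tab h (f u)) u = true).card : ℝ)
          ≤ θ * (2 : ℝ) ^ n := by
  unfold FeatureShadow.PairGapLaw at hG
  obtain ⟨γ, hγ, B, n₀, hGap⟩ := hG
  obtain ⟨θ, hθ, hSh⟩ := hS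
  refine ⟨max θ (1 - γ), max_lt hθ (by linarith), fun C => ?_⟩
  obtain ⟨n₁, hn₁⟩ := hSh C B
  refine ⟨max n₀ n₁, fun n hn c f tab hf => ?_⟩
  have h2n : (0 : ℝ) ≤ (2 : ℝ) ^ n := by positivity
  rcases hGap n (le_trans (le_max_left _ _) hn) c (fun h => tab h false) (fun h => tab h true) with ⟨h0, h1⟩ | hcov
  · have hy := hn₁ n (le_trans (le_max_right _ _) hn) c (fun h u => tab h (f u))
      (fun g => hasDegF_tab f hf (tab g))
      (fun u => by
        cases hfu : f u
        · simpa [hfu] using h0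
        · simpa [hfu] using h1)
    exact le_trans hy (mul_le_mul_of_nonneg_right (le_max_left _ _) h2n)
  · have hsub : (univ.filter fun u : Fin n → Bool => ringWinU c (fun h u => tab h (f u)) u = true) ⊆
        univ.filter fun u : Fin n → Bool =>
          ringWinU c (fun h _ => tab h false) u = true ∨ ringWinU c (fun h _ => tab h true) u = true := by
      intro u hu
      rw [mem_filter] at hu ⊢
      refine ⟨mem_univ _, ?_⟩
      have heq : ringWinU c (fun h u => tab h (f u)) u = ringWinU c (fun h _ => tab h (f u)) u := by
        unfold ringWinU; rfl
      have key : ringWinU c (fun h _ => tab h (f u)) u = true := by rw [← heq]; exact hu.2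
      by_cases hfu : f u = true
      · rw [hfu] at key; right; exact key
      · have hfu' : f u = false := by simpa using hfu
        rw [hfu'] at key; left; exact key
    have hle : ((univ.filter fun u : Fin n → Bool => ringWinU c (fun h u => tab h (f u)) u = true).card : ℝ) ≤
        ((univ.filter fun u : Fin n → Bool =>
          ringWinU c (fun h _ => tab h false) u = true ∨ ringWinU c (fun h _ => tab h true) u = true).card : ℝ) := by
      exact_mod_cast card_le_card hsub
    exact le_trans (le_trans hle hcov) (mul_le_mul_of_nonneg_right (le_max_right _ _) h2n)


/-- **the K = 1 rung for every prime `p ≠ 3`.** -/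
theorem walkHardFFeatOne_holds (p : ℕ) [Fact p.Prime] (hp3 : p ≠ 3) :
    ∃ θ : ℝ, θ < 1 ∧ ∀ C : ℕ, ∃ n₀ : ℕ, ∀ n ≥ n₀, ∀ c : ℕ, ∀ f : (Fin n → Bool) → Bool,
      ∀ tab : Fin (n + 1) → Bool → Bool, HasDegF p f ((Nat.log 2 n) ^ C) →
        ((univ.filter fun u : Fin n → Bool => ringWinU c (fun h u => tab h (f u)) u = true).card : ℝ)
          ≤ θ * (2 : ℝ) ^ n :=
  walkHardFFeatOne_of_pairGap p pairGapLaw (shotsConstF_holds p hp3)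


end FeatureShadowClosing

end Summit.QuantumAdvantage.QuantumAdvantage.Theorems
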